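import Literature.NumberTheory.EllipticCurves.ZpExtensionEisensteinTwistDualityForm
import Literature.NumberTheory.EllipticCurves.ZpExtensionScalarTwistMaps
import HarnessLib

/-!
# Level compatibility of the duality forms on the Eisenstein tower: `e_k(r s, r t) = (e_{k'}(s, t) mod p^k)`
# (the `e_red` clause of the cell's `DVRSetting.SatisfiesH`; proofs file)

Topic `NumberTheory/EllipticCurves` (sequel to `ZpExtensionEisensteinTwistDualityForm`, `ZpExtensionScalarTwistMaps`).
THEOREMS ONLY (no definition, no named fact, no instance, no `sorry`).

For `k ≤ k'`, the reduction `r : M' ⊗ A_{m,k'} → M ⊗ A_{m,k}`, `c ⊗ a ↦ (c mod (q_m, p^k)) ⊗ f(a)` (tree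
`ZpExtension.eisensteinTwistReduceLinear hkk' f`, `f` the level map, e.g. `P ↦ p^{k'-k} P` on `E[p^{k'}] → E[p^k]`),
intertwines the `A`-valued duality forms of `ZpExtensionEisensteinTwistDualityForm`:
**`e_k(r s, r t) = reduce (e_{k'}(s, t))`** (`eisensteinDualityForm_reduce`), as soon as the `E`-level forms are
compatible, `ẽ_k(f a, f b) = (ẽ_{k'}(a, b) mod p^k)` (for the Weil pairings with a compatible system of roots of unity:
`e_{p^k}(p^{d} P, p^{d} Q) = e_{p^{k+d}}(P, Q)^{p^d}`). Ingredients: `EisensteinCoeff.reduce_comp_ofZMod` (the two ring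
maps `ℤ/p^{k'} → A_{m,k}` agree: `Subsingleton (ZMod n →+* R)`).

References: [Howard2004HeegnerKolyvagin] B. Howard, Compositio Math. 140 (2004), §1.6 (arXiv p. 11 L33–38: the tower
`T^{(k)}` with its induced pairings), Lemma 2.1.1, §2.2. BSD is not proved by any of this.
-/

noncomputable section

open scoped TensorProduct

namespace Literature.NumberTheory.EllipticCurves

open Literature.NumberTheory.GaloisRepresentations

namespace IwasawaAlgebra

variable (p : ℕ) [hp : Fact p.Prime] {m : ℕ} (hm : 1 ≤ m) {k k' : ℕ} (hkk' : k ≤ k')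

/-- **`reduce ∘ ι_{k'} = ι_k ∘ (ℤ/p^{k'} → ℤ/p^k)`**: the structure maps `ℤ/p^· → A_{m,·}` commute with reduction (any two
ring maps out of `ℤ/p^{k'}` into `A_{m,k}` coincide). [cite: Howard2004HeegnerKolyvagin, §2.2 (A_𝔮/p^k ↠ A_𝔮/p^{k'})] -/
theorem EisensteinCoeff.reduce_ofZMod (x : ZMod (p ^ k')) :
    EisensteinCoeff.reduce p m hkk' (EisensteinCoeff.ofZMod p hm k' x) =
      EisensteinCoeff.ofZMod p hm k (ZMod.castHom (pow_dvd_pow p hkk') (ZMod (p ^ k)) x) := by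
  have h : (EisensteinCoeff.reduce p m hkk').comp (EisensteinCoeff.ofZMod p hm k') =
      (EisensteinCoeff.ofZMod p hm k).comp (ZMod.castHom (pow_dvd_pow p hkk') (ZMod (p ^ k))) :=
    Subsingleton.elim _ _
  exact RingHom.congr_fun h x

end IwasawaAlgebra

namespace ZpExtension

open IwasawaAlgebra

variable {p : ℕ} [hp : Fact p.Prime] {m : ℕ} (hm : 1 ≤ m) {k k' : ℕ} (hkk' : k ≤ k')
  {M : Type} {M' : Type} [AddCommGroup M] [AddCommGroup M']
  (eb : M →+ M →+ ZMod (p ^ k)) (eb' : M' →+ M' →+ ZMod (p ^ k')) (f : M' →ₗ[ℤ] M)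
  (hf : ∀ a b : M', eb (f a) (f b) = ZMod.castHom (pow_dvd_pow p hkk') (ZMod (p ^ k)) (eb' a b))

include hf in
/-- **Level compatibility of the duality forms**: `e_k(r s, r t) = reduce (e_{k'}(s, t))` for the reduction
`r = eisensteinTwistReduceLinear hkk' f : M' ⊗ A_{m,k'} → M ⊗ A_{m,k}` and `E`-level forms with
`ẽ_k(f a, f b) = ẽ_{k'}(a, b) mod p^k` — the `e_red` compatibility of the levelwise H.4 data on Howard's tower `T^{(k)}`.
[cite: Howard2004HeegnerKolyvagin, §1.6 (arXiv p. 11, L33–38) and Lemma 2.1.1] -/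
theorem eisensteinDualityForm_reduce (s t : EisensteinCoeff.Twisted p m k' M') :
    eisensteinDualityForm hm k eb (eisensteinTwistReduceLinear (p := p) hkk' f s) (eisensteinTwistReduceLinear (p := p) hkk' f t) =
      EisensteinCoeff.reduce p m hkk' (eisensteinDualityForm hm k' eb' s t) := by
  rw [scalarForm_apply_apply, scalarForm_apply_apply]
  induction s using EisensteinCoeff.Twisted.induction_on with
  | zero => simp only [map_zero, AddMonoidHom.zero_apply]
  | tmul c₁ a₁ =>
    induction t using EisensteinCoeff.Twisted.induction_on with
    | zero => simp only [map_zero]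
    | tmul c₂ a₂ =>
      rw [eisensteinTwistReduceLinear_tmul, eisensteinTwistReduceLinear_tmul, scalarFormHom_twisted_tmul_tmul,
        scalarFormHom_twisted_tmul_tmul, map_mul, map_mul, EisensteinCoeff.reduce_ofZMod p hm hkk', hf]
    | add y y' hy hy' => rw [map_add, map_add, map_add, map_add, hy, hy']
  | add x x' hx hx' =>
    rw [map_add, map_add, AddMonoidHom.add_apply, map_add, AddMonoidHom.add_apply, map_add, hx, hx']

end ZpExtension

end Literature.NumberTheory.EllipticCurves
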